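/-
Copyright: the b2b-balaban T⁴-continuum CRUX team, row NE7b, leaf lineage `t4-ne7b-formalise-leaf-02` (gen 132). Project licence.
-/
import Summits.QuantumFields.BalabanUV.T4Continuum.Spine.NE7b.LinearisedLatticeStokes
import Literature.MathematicalPhysics.QuantumFieldTheory.Balaban1983to89.B7Prop3GeneralLinear

/-!
# THE DICTIONARY BETWEEN [B7]'s ROTATED PATH SUMS AND THE PAIR-HOLONOMY PACKET: `(R_{0,y}A)(Γ) = toAdd (hol ⟨A, V₀⟩ y Γ).left` for EVERY word,
# with `R(·) = conjR` as a hom `𝔸ˣ →* MulAut (Multiplicative 𝔸)`; hence the main term (125) of the one-step average — the memo's `M_1` — is the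
# block average of the TRANSPORTED `N`-parts of the straight segments `[x, x + Le_κ]`; and the curl's locality letter `ℓ = 1`: the `N`-part of a
# plaquette word has size at most the sum of the four bond sizes when `φ` is size-isometric (row NE7b, node U5c; `SectE-interface-proof.md` §5.1
# (`M_k`), §5.2 Lemma CS (ii) «each bond carries the transport `Ad(V(·)W_{x′,t})`», §5.4 «`|∂_V E_kA(P)|² ≤ 4(1+ε_F)²Σ_{c∈∂P}|E_kA(c)|²`»;
# E-side key reading: the bridge from the NE7c crew's typed [B7] objects to leaf-05's `LinearisedLatticeStokes` packet, on which Lemma CS (i)∕(ii)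
# at `k = 1` can be written against `Q0cov` BY NAME)

Cell `pub-balaban`, sub-cell `t4`, spine estimate NE7b (`T4WeightBudget.RelWeightBound`; the cell's OWN estimate — NOT PRINTED in
[Bałaban 1983–89], NOT PROVED).  Crux-route work under `Spine/NE7b/` by the row's E-side ∕ key-readings ∕ lattice-geometry leaf lineage; NOTHING
of Bałaban's is asserted beyond what the imported Literature modules define; no `T4Continuum/Support` leaf typed; no `def`, no notation (the hom
`φ` and the pair configuration `W` are carried by characterising hypotheses, inhabited by `exists_*` theorems — the packet's own convention,
`LinearisedLatticeStokesUnitary.exists_mulAut_unitaryAd`); zero `sorry`.  Imports (hub oleans present), REUSED BY NAME: leaf-05 g154's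
`…LinearisedLatticeStokes` (`right_hol`, `right_stepHol`, `left_hol_plaqWord`, `aut_aut`; through it `B7Prop1Explicit.hol ∕ stepHol ∕ …`) and
`Literature.….B7Prop3GeneralLinear` (`Q0cov` = (125); through it `B7Prop3GeneralRotated.tsum ∕ tstep` = `(R_{0,y}A)(Γ)` of p. 28 and
`B7Eq78Linearization.conjR` = `R(X)Y = XYX⁻¹` of (56)).

WHY (located).  Lemma CS (ii) of the memo compares «the four `M_k`-terms entering `(∂_V M_kA)(P)`» — rotated straight-segment sums carrying [B7]'s
transports `R(V₀(Γ_{c₋,x}))` ((125): `(Q₀A)_c = Σ_{x∈B(c₋)} L^{−(d+1)}(R_{0,c₋}A)([x, x′])`, the tree's `B7Prop3GeneralLinear.Q0cov` with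
`tsum_treeWord_seg`) — with «the four sides of `∂S_x(P)`» whose `N`-parts leaf-05's packet controls (`LinearisedLatticeStokesRectangle.
norm_rectWord_sub_sum_le`: boundary pair holonomy = transported curls + curvature defect; `sz_transport_quotient_le`: two transports of one form differ
by `≤ c·dist1(loop)·sz`).  The two sides live in different currencies: [B7]'s `tsum V₀ A y Γ : 𝔸` (recursion (58) with `conjR`) versus the
packet's `(hol W y Γ).left : N` for a pair configuration `W : bonds → N ⋊[φ] G`.  THIS FILE is the exact dictionary (`N = Multiplicative 𝔸`,
`G = 𝔸ˣ`, `φ = conjR`, `W = ⟨ofAdd ∘ A, V₀⟩`): after it, every word identity of the packet is an identity of [B7]'s rotated sums, and (125) reads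
as a block average of transported segment `N`-parts — the form Lemma CS (ii) starts from.  §1 is the curl-locality letter `ℓ` of
`…AveragedCurlFormSplit` (`|X_P B| ≤ ℓ·Σ_{c∈∂P} sz B c`) at its honest value `ℓ = 1` for size-isometric `φ` (unitary `Ad`: `LinearisedLatticeStokesUnitary`).

WHAT IS PROVED ([folklore]; `𝔸` a normed ring for §2–§4, any groups `G`, `N` for §1):
* §1 **`sz_left_hol_plaqWord_le`** — THE CURL's LOCALITY LETTER `ℓ = 1`: for a pair configuration `W = ⟨A, U⟩` and a size `sz` on `N` that is
  subadditive, inversion-invariant and `φ`-isometric, `sz (∂p).left ≤ sz A(x,κ) + sz A(x+e_κ,μ) + sz A(x+e_μ,κ) + sz A(x,μ)` (`left_hol_plaqWord` BY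
  NAME: `(∂p).left = a₁·φ(u₁)a₂·(φ(u₁u₂u₃⁻¹)a₃)⁻¹·(φ(U(∂p))a₄)⁻¹`); `norm_left_hol_plaqWord_le` — the same for `N = Multiplicative V`, `V` seminormed,
  `sz = ‖toAdd ·‖`, from the isometry letter alone.
* §2 **`exists_mulAut_conjR`** — `R` AS THE HOM THE PACKET WANTS: there is `φ : 𝔸ˣ →* MulAut (Multiplicative 𝔸)` with
  `toAdd (φ u a) = conjR u (toAdd a) = u·a·u⁻¹` (hom law = `B7Prop3GeneralRotated.conjR_mul_left`); `exists_pairCfg` (the pair configuration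
  `W = ⟨ofAdd ∘ A, V₀⟩` exists); private bookkeeping `conjR_one_left`, `conjR_neg` (public twins: `B7Prop3GeneralLinearSplit` (private),
  `B8Eq146AExpansion.conjR_neg` — not imported for one `simp` line).
* §3 **`toAdd_left_stepHol`**, **`toAdd_left_hol_eq_tsum`** — THE DICTIONARY: for any such `φ` and `W`, and EVERY word `Γ` from `y`,
  `toAdd (hol W y Γ).left = tsum V₀ A y Γ` (= `(R_{0,y}A)(Γ)`; induction on the word: the packet's cocycle `(l·w).left = l.left·φ(l.right)w.left`
  is (58)'s recursion, backward letters included: `(W⁻¹).left = φ(g⁻¹)(n⁻¹)` ↔ `tstep`'s `−R(V₀(b)⁻¹)A_b`); `right_hol` gives `(hol W y Γ).right = V₀(Γ)`.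
* §4 **`Q0cov_eq_sum_pairHol`** — (125) IN THE PACKET's CURRENCY: `(Q₀A)_c = Σ_{x∈B(c₋)} L^{−(d+1)}·toAdd (φ(V₀(Γ_{c₋,x})) (hol W x [x, x+Le_κ]).left)`
  with `V₀(Γ_{c₋,x}) = (hol W c₋ Γ_{c₋,x}).right` (`Q0cov_eq_sum_pairHol'`) — the memo's `M_1`: «each bond carries the transport `Ad(W_{x,t})`,
  `W_{x,t} = U(Γ_{y,x})·U([x, x + tηe_μ])`».

NOT HERE (honest): Lemma CS (ii)∕(iii) itself at `k = 1` (the comparison of (125)'s transports with the contour transports of `∂S_x(P)` through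
`sz_transport_quotient_le`, the re-indexing `B(c₋ + Le_κ) = B(c₋) + Le_κ`, the coarse background `V = Ū` and (R-V) — `B7Eq47AveragedBondVsStraight`
territory); (R-M) (`…OneStepAveragingRemainder` is its `k = 1` remainder letter); the counting (`…CovariantStokesCounting` ∕ `…BlockSurfaceMultiplicity`);
any value of `ε_F`, `c_g`; the torus; which `𝔸`, `G ⊂ 𝔸ˣ` are Bałaban's ((A3) ∕ (A1c), NC-NE7b-α UNRULED).  BY-NAME EFFECT ON THE WALL: NONE
(a dictionary and one letter of the (h1) slot at its value `ℓ = 1`; the wall is (R2)).  NE7b NOT PRINTED ∕ NOT PROVED; spine PROVED 0∕9; rung (B)+1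
on a FINITE torus — NOT infinite volume, NOT the mass gap, NOT Clay.
HONEST DEPENDENCY: continuum YM on T⁴ ⇐ BetaPertH ∧ nine spine estimates (0/9 proved); BetaPertH ⇐ (D1) ∧ (D4) ∧ CAP+tail; G-an2-4 gates
asym, D1 and NE2/3/4.
-/

set_option autoImplicit false

noncomputable section

open scoped BigOperators
open Literature.MathematicalPhysics.QuantumFieldTheory.Balaban1983to89
open Literature.MathematicalPhysics.QuantumFieldTheory.Balaban1983to89.B7Prop1Explicit
  (Site Letter e hol hol_nil hol_cons stepHol stepHol_true stepHol_false plaqWord seg treeWord boxVec)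
open Literature.MathematicalPhysics.QuantumFieldTheory.Balaban1983to89.B7Eq78Linearization (conjR conjR_apply conjR_add)
open Literature.MathematicalPhysics.QuantumFieldTheory.Balaban1983to89.B7Prop3GeneralRotated (tsum tstep tsum_cons tsum_nil conjR_mul_left)
open Literature.MathematicalPhysics.QuantumFieldTheory.Balaban1983to89.B7Prop3GeneralLinear (Q0cov)
open Summit.QuantumFields.BalabanUV.T4Continuum.NE7b.LinearisedLatticeStokes (right_hol right_stepHol left_hol_plaqWord aut_aut)

namespace Summit.QuantumFields.BalabanUV.T4Continuum.NE7b.RotatedSumPairHolonomy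

variable {d : ℕ}

/-! ## §1 The curl's locality letter `ℓ = 1`: the `N`-part of a plaquette word is size-bounded by its four bonds -/

section CurlLocality

variable {G N : Type*} [Group G] [Group N] {φ : G →* MulAut N}

/-- **THE CURL's LOCALITY LETTER `ℓ = 1`.**  For a pair configuration `W = ⟨A, U⟩` and a size `sz : N → ℝ` that is subadditive
(`sz(ab) ≤ sz a + sz b`), inversion-invariant (`sz a⁻¹ = sz a`) and `φ`-isometric (`sz (φ g a) = sz a`):
`sz (hol W x ∂p_{κμ}).left ≤ sz A(x,κ) + sz A(x+e_κ,μ) + sz A(x+e_μ,κ) + sz A(x,μ)` — the linearised covariant curl of a plaquette is controlled by the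
1-form on its own four bonds with constant ONE (`LinearisedLatticeStokes.left_hol_plaqWord` BY NAME). [folklore] -/
theorem sz_left_hol_plaqWord_le (W : Site d → Fin d → N ⋊[φ] G) (U : Site d → Fin d → G) (hU : ∀ y k, (W y k).right = U y k)
    (sz : N → ℝ) (hmul : ∀ a b, sz (a * b) ≤ sz a + sz b) (hinv : ∀ a, sz a⁻¹ = sz a)
    (hiso : ∀ (g : G) (a : N), sz (φ g a) = sz a) (x : Site d) (κ μ : Fin d) :
    sz (hol W x (plaqWord κ μ)).left
      ≤ sz (W x κ).left + sz (W (x + e κ) μ).left + sz (W (x + e μ) κ).left + sz (W x μ).left := by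
  -- the four-factor shape `a · φ(g₁)b · (φ(g₂)c)⁻¹ · (φ(g₃)d′)⁻¹` of `left_hol_plaqWord`, sized letter by letter
  have key : ∀ (a b c d' : N) (g₁ g₂ g₃ : G),
      sz (a * φ g₁ b * (φ g₂ c)⁻¹ * (φ g₃ d')⁻¹) ≤ sz a + sz b + sz c + sz d' := by
    intro a b c d' g₁ g₂ g₃
    have h1 := hmul (a * φ g₁ b * (φ g₂ c)⁻¹) ((φ g₃ d')⁻¹)
    have h2 := hmul (a * φ g₁ b) ((φ g₂ c)⁻¹)
    have h3 := hmul a (φ g₁ b)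
    rw [hinv, hiso] at h1 h2
    rw [hiso] at h3
    linarith
  rw [left_hol_plaqWord W U hU x κ μ]
  exact key _ _ _ _ _ _ _

/-- **… IN NORMED LETTERS** (`N = Multiplicative V`, `V` a seminormed additive commutative group, `sz = ‖toAdd ·‖`): from the isometry letter
`‖toAdd (φ g a)‖ = ‖toAdd a‖` alone, `‖toAdd (hol W x ∂p_{κμ}).left‖ ≤ ‖A(x,κ)‖ + ‖A(x+e_κ,μ)‖ + ‖A(x+e_μ,κ)‖ + ‖A(x,μ)‖` — the memo's
«`|∂_V B(P)| ≤ (1+ε_F)·Σ_{c∈∂P}|B(c)|`» at `ℓ = 1` for isometric transports. [folklore] -/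
theorem norm_left_hol_plaqWord_le {V : Type*} [SeminormedAddCommGroup V] {ψ : G →* MulAut (Multiplicative V)}
    (W : Site d → Fin d → Multiplicative V ⋊[ψ] G) (U : Site d → Fin d → G) (hU : ∀ y k, (W y k).right = U y k)
    (hiso : ∀ (g : G) (a : Multiplicative V), ‖(ψ g a).toAdd‖ = ‖a.toAdd‖) (x : Site d) (κ μ : Fin d) :
    ‖(hol W x (plaqWord κ μ)).left.toAdd‖
      ≤ ‖(W x κ).left.toAdd‖ + ‖(W (x + e κ) μ).left.toAdd‖ + ‖(W (x + e μ) κ).left.toAdd‖ + ‖(W x μ).left.toAdd‖ :=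
  sz_left_hol_plaqWord_le W U hU (fun a => ‖a.toAdd‖) (fun a b => by rw [toAdd_mul]; exact norm_add_le _ _)
    (fun a => by rw [toAdd_inv, norm_neg]) hiso x κ μ

end CurlLocality

/-! ## §2 `R(X)Y = XYX⁻¹` as a hom `𝔸ˣ →* MulAut (Multiplicative 𝔸)`; the pair configuration `⟨ofAdd ∘ A, V₀⟩` -/

section ConjHom

variable {𝔸 : Type*} [NormedRing 𝔸]

/-- `R(1) = id` (bookkeeping; private as in `B7Prop3GeneralLinearSplit`). [folklore] -/
private theorem conjR_one_left (Y : 𝔸) : conjR (1 : 𝔸ˣ) Y = Y := by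
  simp [conjR_apply]

/-- `R(X)(−Y) = −R(X)Y` (bookkeeping; the public copy is `B8Eq146AExpansion.conjR_neg`, not imported — private here). [folklore] -/
private theorem conjR_neg (X : 𝔸ˣ) (Y : 𝔸) : conjR X (-Y) = -conjR X Y := by
  simp [conjR_apply, mul_neg, neg_mul]

/-- **`R` AS THE HOM THE PACKET WANTS**: there is `φ : 𝔸ˣ →* MulAut (Multiplicative 𝔸)` with `toAdd (φ u a) = R(u)(toAdd a) = u·a·u⁻¹` —
the `Multiplicative` transcription of the additive automorphisms `R(u)` ((56); hom law from `conjR_mul_left`). [folklore] -/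
theorem exists_mulAut_conjR :
    ∃ φ : 𝔸ˣ →* MulAut (Multiplicative 𝔸), ∀ (u : 𝔸ˣ) (a : Multiplicative 𝔸), (φ u a).toAdd = conjR u a.toAdd := by
  classical
  let e : 𝔸ˣ → 𝔸 ≃+ 𝔸 := fun u =>
    { toFun := conjR u
      invFun := conjR u⁻¹
      left_inv := fun a => by rw [← conjR_mul_left, inv_mul_cancel, conjR_one_left]
      right_inv := fun a => by rw [← conjR_mul_left, mul_inv_cancel, conjR_one_left]
      map_add' := conjR_add u }
  refine ⟨MonoidHom.mk' (fun u => AddEquiv.toMultiplicative (e u)) ?_, ?_⟩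
  · intro u v
    apply MulEquiv.ext
    intro a
    show Multiplicative.ofAdd (conjR (u * v) a.toAdd) = Multiplicative.ofAdd (conjR u (Multiplicative.ofAdd (conjR v a.toAdd)).toAdd)
    rw [toAdd_ofAdd, conjR_mul_left]
  · intro u a
    rfl

/-- **THE PAIR CONFIGURATION `W = ⟨ofAdd ∘ A, V₀⟩` EXISTS** (carried below by its two characterising hypotheses). [folklore] -/
theorem exists_pairCfg {φ : 𝔸ˣ →* MulAut (Multiplicative 𝔸)} (A : Site d → Fin d → 𝔸) (V₀ : Site d → Fin d → 𝔸ˣ) :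
    ∃ W : Site d → Fin d → Multiplicative 𝔸 ⋊[φ] 𝔸ˣ,
      (∀ x κ, (W x κ).left = Multiplicative.ofAdd (A x κ)) ∧ (∀ x κ, (W x κ).right = V₀ x κ) :=
  ⟨fun x κ => ⟨Multiplicative.ofAdd (A x κ), V₀ x κ⟩, fun _ _ => rfl, fun _ _ => rfl⟩

end ConjHom

/-! ## §3 The dictionary: `toAdd (hol W y Γ).left = (R_{0,y}A)(Γ)` for every word -/

section Dictionary

variable {𝔸 : Type*} [NormedRing 𝔸] {φ : 𝔸ˣ →* MulAut (Multiplicative 𝔸)}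
  (hφ : ∀ (u : 𝔸ˣ) (a : Multiplicative 𝔸), (φ u a).toAdd = conjR u a.toAdd)
  {A : Site d → Fin d → 𝔸} {V₀ : Site d → Fin d → 𝔸ˣ} (W : Site d → Fin d → Multiplicative 𝔸 ⋊[φ] 𝔸ˣ)
  (hWl : ∀ x κ, (W x κ).left = Multiplicative.ofAdd (A x κ)) (hWr : ∀ x κ, (W x κ).right = V₀ x κ)

include hφ hWl hWr in
/-- **ONE LETTER**: the `N`-part of the one-letter pair transport is [B7]'s `tstep` — forward `A_b`, backward `−R(V₀(b)⁻¹)A_b`. [folklore] -/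
theorem toAdd_left_stepHol (x : Site d) (l : Letter d) : (stepHol W x l).left.toAdd = tstep V₀ A x l := by
  obtain ⟨κ, b⟩ := l
  cases b
  · rw [stepHol_false, SemidirectProduct.inv_left, hφ, toAdd_inv, hWl, hWr, toAdd_ofAdd, conjR_neg]
    simp [tstep, stepHol_false, sub_eq_add_neg]
  · rw [stepHol_true, hWl, toAdd_ofAdd]
    simp [tstep]

include hφ hWl hWr in
/-- **THE DICTIONARY.**  For EVERY word `Γ` from `y`: `toAdd (hol W y Γ).left = tsum V₀ A y Γ = (R_{0,y}A)(Γ)` — the packet's cocycle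
`(l·w).left = l.left · φ(l.right) w.left` IS (58)'s recursion `(R_{0,y}A)(l·w) = tstep_l + R(V₀(l))·(R_{0,y+l}A)(w)`. [folklore] -/
theorem toAdd_left_hol_eq_tsum : ∀ (y : Site d) (w : List (Letter d)), (hol W y w).left.toAdd = tsum V₀ A y w
  | y, [] => by rw [hol_nil, SemidirectProduct.one_left, toAdd_one, tsum_nil]
  | y, l :: w => by
    rw [hol_cons, SemidirectProduct.mul_left, toAdd_mul, hφ, toAdd_left_stepHol hφ W hWl hWr,
      right_stepHol W V₀ hWr, toAdd_left_hol_eq_tsum (y + l.vec) w, tsum_cons]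

include hWr in
/-- The `G`-part is the background transport `V₀(Γ)` (`LinearisedLatticeStokes.right_hol`). [folklore] -/
theorem right_hol_eq (y : Site d) (w : List (Letter d)) : (hol W y w).right = hol V₀ y w :=
  right_hol W V₀ hWr y w

end Dictionary

/-! ## §4 (125) in the packet's currency: the main term `M_1` is the block average of transported segment `N`-parts -/

section MainTerm

variable {𝔸 : Type*} [NormedRing 𝔸] [NormedAlgebra ℂ 𝔸] {φ : 𝔸ˣ →* MulAut (Multiplicative 𝔸)}
  (hφ : ∀ (u : 𝔸ˣ) (a : Multiplicative 𝔸), (φ u a).toAdd = conjR u a.toAdd)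
  {A : Site d → Fin d → 𝔸} {V₀ : Site d → Fin d → 𝔸ˣ} (W : Site d → Fin d → Multiplicative 𝔸 ⋊[φ] 𝔸ˣ)
  (hWl : ∀ x κ, (W x κ).left = Multiplicative.ofAdd (A x κ)) (hWr : ∀ x κ, (W x κ).right = V₀ x κ)

include hφ hWl hWr in
/-- **(125) = THE MEMO's `M_1` IN THE PACKET's CURRENCY**: `(Q₀A)_c = Σ_{x∈B(c₋)} L^{−(d+1)}·toAdd (φ(V₀(Γ_{c₋,x})) (hol W x [x, x+Le_κ]).left)` —
each straight segment's linearised holonomy, transported to `c₋` along the tree contour: «each bond carries `Ad(W_{x,t})`,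
`W_{x,t} = U(Γ_{y,x})·U([x, x+tηe_μ])`». [folklore] -/
theorem Q0cov_eq_sum_pairHol (L : ℕ) (q : Site d) (κ : Fin d) :
    Q0cov L V₀ A q κ = ∑ r : Fin d → Fin L, (((L : ℝ) ^ (d + 1))⁻¹) •
      (φ (hol V₀ q (treeWord (boxVec L r))) (hol W (q + boxVec L r) (seg κ L)).left).toAdd := by
  unfold Q0cov
  refine Finset.sum_congr rfl fun r _ => ?_
  rw [hφ, toAdd_left_hol_eq_tsum hφ W hWl hWr]

include hφ hWl hWr in
/-- … with the transport read off the pair holonomy of the tree contour itself: `V₀(Γ_{c₋,x}) = (hol W c₋ Γ_{c₋,x}).right`. [folklore] -/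
theorem Q0cov_eq_sum_pairHol' (L : ℕ) (q : Site d) (κ : Fin d) :
    Q0cov L V₀ A q κ = ∑ r : Fin d → Fin L, (((L : ℝ) ^ (d + 1))⁻¹) •
      (φ (hol W q (treeWord (boxVec L r))).right (hol W (q + boxVec L r) (seg κ L)).left).toAdd := by
  rw [Q0cov_eq_sum_pairHol hφ W hWl hWr L q κ]
  refine Finset.sum_congr rfl fun r _ => ?_
  rw [right_hol_eq W hWr]

end MainTerm

/-! ## §5 (v1.1, append-only) The dictionary for a general structure group `ι : G →* 𝔸ˣ` — the packet's `U(N)` instances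

`LinearisedLatticeStokesRectangle`'s defect END needs a `GaugeGroup G` (for `dist1`); the cell's instances are `U(n)` ∕ `SU(n)`
(`LinearisedLatticeStokesUnitary`), not `𝔸ˣ`.  The dictionary of §3 holds verbatim for ANY group `G` mapped into the units by a hom `ι` (print:
`G ⊂ U(N) ⊂ M_N(ℂ)ˣ`), with the [B7] background `V₀ := ι ∘ U` and `φ` reading `R ∘ ι`: so the rectangle END, stated for `G = U(n)` with `φ = Ad`,
reads on [B7]'s rotated sums of the matrix-valued form. -/

section StructureGroup

variable {𝔸 : Type*} [NormedRing 𝔸] {G : Type*} [Group G] (ι : G →* 𝔸ˣ) {φ : G →* MulAut (Multiplicative 𝔸)}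
  (hφ : ∀ (g : G) (a : Multiplicative 𝔸), (φ g a).toAdd = conjR (ι g) a.toAdd)
  {A : Site d → Fin d → 𝔸} {U : Site d → Fin d → G} (W : Site d → Fin d → Multiplicative 𝔸 ⋊[φ] G)
  (hWl : ∀ x κ, (W x κ).left = Multiplicative.ofAdd (A x κ)) (hWr : ∀ x κ, (W x κ).right = U x κ)

/-- The [B7] background of a `G`-valued configuration: `V₀ = ι ∘ U`, and `ι` commutes with transport (`LinearisedLatticeStokes.map_hol`). [folklore] -/
theorem map_hol_eq (y : Site d) (w : List (Letter d)) : ι (hol U y w) = hol (fun x κ => ι (U x κ)) y w :=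
  LinearisedLatticeStokes.map_hol ι U y w

include hφ hWl hWr in
/-- **ONE LETTER, general structure group**: `toAdd (stepHol W x l).left = tstep (ι ∘ U) A x l`. [folklore] -/
theorem toAdd_left_stepHol_hom (x : Site d) (l : Letter d) :
    (stepHol W x l).left.toAdd = tstep (fun y κ => ι (U y κ)) A x l := by
  obtain ⟨κ, b⟩ := l
  cases b
  · rw [stepHol_false, SemidirectProduct.inv_left, hφ, toAdd_inv, hWl, hWr, toAdd_ofAdd, map_inv, conjR_neg]
    simp [tstep, stepHol_false, sub_eq_add_neg]
  · rw [stepHol_true, hWl, toAdd_ofAdd]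
    simp [tstep]

include hφ hWl hWr in
/-- **THE DICTIONARY, general structure group**: for EVERY word, `toAdd (hol W y Γ).left = (R_{0,y}A)(Γ)` computed with the [B7] background
`V₀ = ι ∘ U` — so the packet's `U(N)` ∕ `SU(N)` instances (with `φ = Ad`, `ι` the inclusion into `M_N(ℂ)ˣ`) read on [B7]'s rotated sums. [folklore] -/
theorem toAdd_left_hol_eq_tsum_hom :
    ∀ (y : Site d) (w : List (Letter d)), (hol W y w).left.toAdd = tsum (fun x κ => ι (U x κ)) A y w
  | y, [] => by rw [hol_nil, SemidirectProduct.one_left, toAdd_one, tsum_nil]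
  | y, l :: w => by
    rw [hol_cons, SemidirectProduct.mul_left, toAdd_mul, hφ, toAdd_left_stepHol_hom ι hφ W hWl hWr,
      right_stepHol W U hWr, LinearisedLatticeStokes.map_stepHol ι U, toAdd_left_hol_eq_tsum_hom (y + l.vec) w, tsum_cons]

end StructureGroup

end Summit.QuantumFields.BalabanUV.T4Continuum.NE7b.RotatedSumPairHolonomy

end
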